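/-
Copyright: derived here (Resolution Observatory cell `pub-rosobs`, carver gen 50). AI-written Lean; AI review is
weaker than expert review.  Companion file of the cell's POLYNOMIAL weighted-centre model `W(f)`: STEP 3_Q of engine 1's
LEMMA LQ (THEOREM-FQ-eng1-g34 §15.1; CARVER-NOTES-eng1-g34 T20).  Instrument — NOT a resolution theorem and NOT a statement
about the invariant of [AbramovichTemkinWlodarczyk2024].
-/
import Literature.AlgebraicGeometry.Resolution.WeightedCentreGapTables
import Mathlib.Data.Nat.Prime.Basic
import Mathlib.Tactic.IntervalCases
import Mathlib.Tactic.NormNum.Prime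
import Mathlib.Tactic.Positivity
import HarnessLib

/-!
# The quartic-boundary weights `p/(4(p+1))` and `p/(2(p+1))` are not class weights

In the cell's bookkeeping a slot weight is LEGAL (a "class weight", `IsClassWeight` of `WeightedCentreGapTables`) iff it is
`≤ 1/5` or one of `U = {5/24, 2/9, 1/4, 1/3, 1/2}`.  At the (O2) point `ρ = 1/(4(p+1))` a pure term `σ^j` with `p ∣ j` would
sit at weight `j·ρ ∈ {p/(4(p+1)), p/(2(p+1))}` (`j = p, 2p`; `j ≥ 3p` exceeds `1/2`):

* `not_isClassWeight_div_four_mul_succ` : for `6 ≤ p`, `p ≠ 8`, `p/(4(p+1))` is not a class weight (it lies in `(1/5, 1/4)` and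
  equals `5/24` iff `p = 5`, `2/9` iff `p = 8`); `not_isClassWeight_div_four_mul_succ_of_prime` : the case `p` prime, `7 ≤ p`;
* `not_isClassWeight_div_two_mul_succ` : for `3 ≤ p`, `p/(2(p+1)) ∈ (1/3, 1/2)` is not a class weight;
* `lt_half_iff` bookkeeping: `3p/(4(p+1)) > 1/2` for `p ≥ 3` (so `j = 3p` is out of range), and the positive case
  `isClassWeight_five_24ths'` : `5/(4·6) = 5/24` IS a class weight (`p = 5`).

[ATW24] Abramovich–Temkin–Włodarczyk, Algebra & Number Theory 18 (2024), §5.1 (p. 1575).  CONTEXT ONLY; elementary arithmetic, ours.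
-/

namespace Literature.AlgebraicGeometry.Resolution.WeightedBlowup

/-- `p/(4(p+1))` is not a class weight for `6 ≤ p`, `p ≠ 8` (derived here; STEP 3_Q of LEMMA LQ).
[cite: AbramovichTemkinWlodarczyk2024, §5.1 (p. 1575)] -/
theorem not_isClassWeight_div_four_mul_succ {p : ℕ} (hp : 6 ≤ p) (hp8 : p ≠ 8) :
    ¬IsClassWeight ((p : ℚ) / (4 * ((p : ℚ) + 1))) := by
  have hp' : (6 : ℚ) ≤ p := by exact_mod_cast hp
  have hpos : (0 : ℚ) < 4 * ((p : ℚ) + 1) := by positivity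
  rintro ((h | h | h | h | h) | h)
  · rw [div_eq_iff hpos.ne'] at h
    have h5 : (p : ℚ) = 5 := by linarith
    have : p = 5 := by exact_mod_cast h5
    omega
  · rw [div_eq_iff hpos.ne'] at h
    have h8 : (p : ℚ) = 8 := by linarith
    have : p = 8 := by exact_mod_cast h8
    exact hp8 this
  · rw [div_eq_iff hpos.ne'] at h
    linarith
  · rw [div_eq_iff hpos.ne'] at h
    linarith
  · rw [div_eq_iff hpos.ne'] at h
    linarith
  · rw [div_le_iff₀ hpos] at h
    linarith

/-- In particular for a prime `p ≥ 7` (derived here). [cite: AbramovichTemkinWlodarczyk2024, §5.1 (p. 1575)] -/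
theorem not_isClassWeight_div_four_mul_succ_of_prime {p : ℕ} (hp : p.Prime) (h7 : 7 ≤ p) :
    ¬IsClassWeight ((p : ℚ) / (4 * ((p : ℚ) + 1))) := by
  refine not_isClassWeight_div_four_mul_succ (by omega) ?_
  rintro rfl
  exact absurd hp (by norm_num)

/-- `p/(2(p+1))` is not a class weight for `3 ≤ p` (derived here; the pure term `σ^{2p}` at the (O2) point).
[cite: AbramovichTemkinWlodarczyk2024, §5.1 (p. 1575)] -/
theorem not_isClassWeight_div_two_mul_succ {p : ℕ} (hp : 3 ≤ p) :
    ¬IsClassWeight ((p : ℚ) / (2 * ((p : ℚ) + 1))) := by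
  have hp' : (3 : ℚ) ≤ p := by exact_mod_cast hp
  have hpos : (0 : ℚ) < 2 * ((p : ℚ) + 1) := by positivity
  rintro ((h | h | h | h | h) | h)
  · rw [div_eq_iff hpos.ne'] at h
    linarith
  · rw [div_eq_iff hpos.ne'] at h
    linarith
  · rw [div_eq_iff hpos.ne'] at h
    linarith
  · rw [div_eq_iff hpos.ne'] at h
    linarith
  · rw [div_eq_iff hpos.ne'] at h
    linarith
  · rw [div_le_iff₀ hpos] at h
    linarith

/-- `3p/(4(p+1)) > 1/2` for `3 ≤ p`: the pure term `σ^{3p}` is out of the weight range (derived here).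
[cite: AbramovichTemkinWlodarczyk2024, §5.1 (p. 1575)] -/
theorem half_lt_three_mul_div_four_mul_succ {p : ℕ} (hp : 3 ≤ p) :
    (1 : ℚ) / 2 < 3 * (p : ℚ) / (4 * ((p : ℚ) + 1)) := by
  have hp' : (3 : ℚ) ≤ p := by exact_mod_cast hp
  have hpos : (0 : ℚ) < 4 * ((p : ℚ) + 1) := by positivity
  rw [lt_div_iff₀ hpos]
  linarith

/-- General pure exponent `j = m·p` at `ρ = 1/(4(p+1))`: the weight is `m·p/(4(p+1))`, and for `m ≥ 3`, `p ≥ 3` it exceeds `1/2`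
(derived here). [cite: AbramovichTemkinWlodarczyk2024, §5.1 (p. 1575)] -/
theorem half_lt_mul_div_four_mul_succ {p m : ℕ} (hp : 3 ≤ p) (hm : 3 ≤ m) :
    (1 : ℚ) / 2 < (m : ℚ) * (p : ℚ) / (4 * ((p : ℚ) + 1)) := by
  have hp' : (3 : ℚ) ≤ p := by exact_mod_cast hp
  have hm' : (3 : ℚ) ≤ m := by exact_mod_cast hm
  have hpos : (0 : ℚ) < 4 * ((p : ℚ) + 1) := by positivity
  rw [lt_div_iff₀ hpos]
  nlinarith

/-- The positive case `p = 5`: `5/(4·6) = 5/24` IS a class weight (derived here). [cite: AbramovichTemkinWlodarczyk2024, §5.1 (p. 1575)] -/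
theorem isClassWeight_five_div_four_mul_six : IsClassWeight ((5 : ℚ) / (4 * ((5 : ℚ) + 1))) :=
  Or.inl (Or.inl (by norm_num))

/-- Packaging for LEMMA LQ STEP 3_Q: for a prime `p ≥ 7` NO multiple `j = m·p` (`m ≥ 1`) of `p` gives a class weight
`j/(4(p+1)) ≤ 1/2` (derived here). [cite: AbramovichTemkinWlodarczyk2024, §5.1 (p. 1575)] -/
theorem not_isClassWeight_mul_div_four_mul_succ_of_prime {p m : ℕ} (hp : p.Prime) (h7 : 7 ≤ p) (hm : 1 ≤ m)
    (hle : (m : ℚ) * (p : ℚ) / (4 * ((p : ℚ) + 1)) ≤ 1 / 2) :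
    ¬IsClassWeight ((m : ℚ) * (p : ℚ) / (4 * ((p : ℚ) + 1))) := by
  have hpos : (0 : ℚ) < 4 * ((p : ℚ) + 1) := by positivity
  rcases Nat.lt_or_ge m 3 with hm3 | hm3
  · interval_cases m
    · rw [Nat.cast_one, one_mul]; exact not_isClassWeight_div_four_mul_succ_of_prime hp h7
    · have : (2 : ℕ) * (p : ℚ) / (4 * ((p : ℚ) + 1)) = (p : ℚ) / (2 * ((p : ℚ) + 1)) := by
        rw [div_eq_div_iff hpos.ne' (by positivity)]; push_cast; ring
      rw [this]; exact not_isClassWeight_div_two_mul_succ (by omega)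
  · exact absurd hle (not_le.mpr (half_lt_mul_div_four_mul_succ (by omega) hm3))

end Literature.AlgebraicGeometry.Resolution.WeightedBlowup
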